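import Summits.CriticalPhenomena.PercolationContinuityZ3.Theorems.PercNearOneGluingNoHeavyLowerTailSahiOneStepLayerPositive
import HarnessLib

/-!
# One-step scheme: the CONDITIONAL-COVARIANCE and LAYER-SUM criteria for the `(2′)` half of a Hamming-threshold slot

Support file (prover prim-ineq-prove-3 gen 31; `--supports stmt-CriticalPhenomena-4575`; memo
`run/shared/lean/prim/prim-ineq-prove-3/FINDING-G31-NORMAL-FORMS.md` §2).  No definitions, no named facts, no sorries, no `native_decide`.

For an increasing first event `H` (in particular `H = Th_t(F) = {ω | t ≤ #(F ∩ ω)}`) and increasing events `A, B`, the `(2′)` functional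
`n = osN p H 1_A 1_B` of `…SahiOneStepDefs` satisfies the identity (`osN_ind_ind`)
`P(H)·n = (1 − P H)·[P(H)·P(H∩A∩B) − P(H∩A)·P(H∩B)] + Cov(1_A,1_H)·Cov(1_B,1_H)`,
whose last term is nonnegative by Harris.  Hence the two cheapest sufficient conditions for `(2′)`, recorded here once and for all:

* **`osN_nonneg_of_condCov` (CONDITIONAL-COVARIANCE CRITERION):** if `A` and `B` are nonnegatively correlated GIVEN `H`
  (`P(H∩A)·P(H∩B) ≤ P(H)·P(H∩A∩B)`), then `0 ≤ n(H; 1_A, 1_B)` — for every increasing `H` and every density vector; with the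
  `(3′)` half this gives `sahiE3_threshold_nonneg_of_condCov` for threshold slots;
* **`osN_threshold_nonneg_of_layerSum` (LAYER-SUM CRITERION):** if `Σ_{k ≥ t} μ(N_F = k)·Cov(1_A,1_B ∣ N_F = k) ≥ 0`, written division-free-safe as
  `Σ_{k ≥ t} P(A∩N_k)·P(B∩N_k)/P(N_k) ≤ P(Th_t(F) ∩ A ∩ B)` (Lean's `x/0 = 0`), then `0 ≤ n(Th_t(F); 1_A, 1_B)`; this weakens the hypothesis of the
  landed LAYER CRITERION `osN_threshold_nonneg_of_layerPos` (nonnegative correlation on EVERY high layer) to the π-weighted SUM over the high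
  layers (`layerGrid_nonneg_of_sum` is the 1-D inequality; the layer criterion is the pointwise case, since `α_kβ_k ≤ γ_kπ_k` termwise gives the sum).
Numerically (memo of gen 30, lab-gen30/e16_layersum.py) the layer-sum hypothesis holds for ≈ 64 % of random pairs at `n = 5, t = 3` and fails on
the residual (sandwich-free, non-shifted) pairs, which are negatively correlated inside `H`; so these criteria are bookkeeping, not the open core.
-/

noncomputable section

namespace Summit.CriticalPhenomena.PercolationContinuityZ3.Theorems

namespace SahiOneStep

open MeasureTheory Finset
open Literature.Probability.Percolation (DeterminedBy determinedBy_iff)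
open Literature.Probability.LatticeModels (prodBernoulli prodBernoulli_harris sahiE3)
open Literature.Probability.Percolation.DecisionTree (ind)
open scoped Classical

variable {ι : Type*} [Fintype ι] [DecidableEq ι]

/-! ## §1 The conditional-covariance criterion (any increasing first event) -/

omit [DecidableEq ι] in
/-- **`P(H)·n` as a sum of two signed squares-like terms**: for all events `H, A, B`,
`P(H)·n(H;1_A,1_B) = (1 − P H)·(P(H)·P(H∩A∩B) − P(H∩A)·P(H∩B)) + (P(H∩A) − P(H)P(A))·(P(H∩B) − P(H)P(B))`. [this work] -/
theorem real_mul_osN_ind_ind (p : ι → unitInterval) (H A B : Set (Set ι)) :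
    (prodBernoulli p).real H * osN p H (ind A) (ind B) =
      (1 - (prodBernoulli p).real H) *
          ((prodBernoulli p).real H * (prodBernoulli p).real (H ∩ A ∩ B)
            - (prodBernoulli p).real (H ∩ A) * (prodBernoulli p).real (H ∩ B))
        + ((prodBernoulli p).real (H ∩ A) - (prodBernoulli p).real H * (prodBernoulli p).real A)
          * ((prodBernoulli p).real (H ∩ B) - (prodBernoulli p).real H * (prodBernoulli p).real B) := by
  rw [osN_ind_ind]
  ring

omit [DecidableEq ι] in
/-- **CONDITIONAL-COVARIANCE CRITERION.**  For every density vector, every increasing event `H` and increasing events `A, B`: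
if `A` and `B` are nonnegatively correlated given `H`, i.e. `P(H∩A)·P(H∩B) ≤ P(H)·P(H∩A∩B)`, then `0 ≤ n(H; 1_A, 1_B)`
(`Cov(1_A,1_B) ≥ P(Hᶜ)·Cov(1_A,1_B ∣ Hᶜ)`). [this work] -/
theorem osN_nonneg_of_condCov (p : ι → unitInterval) {H A B : Set (Set ι)}
    (hH : IsUpperSet H) (hA : IsUpperSet A) (hB : IsUpperSet B)
    (hcov : (prodBernoulli p).real (H ∩ A) * (prodBernoulli p).real (H ∩ B) ≤
      (prodBernoulli p).real H * (prodBernoulli p).real (H ∩ A ∩ B)) :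
    0 ≤ osN p H (ind A) (ind B) := by
  set μ := prodBernoulli p with hμ
  have hHA : μ.real H * μ.real A ≤ μ.real (H ∩ A) :=
    prodBernoulli_harris p hH hA MeasurableSet.of_discrete MeasurableSet.of_discrete
  have hHB : μ.real H * μ.real B ≤ μ.real (H ∩ B) :=
    prodBernoulli_harris p hH hB MeasurableSet.of_discrete MeasurableSet.of_discrete
  have hh0 : 0 ≤ μ.real H := measureReal_nonneg
  have hh1 : μ.real H ≤ 1 := measureReal_le_one
  have key := real_mul_osN_ind_ind p H A B
  rw [← hμ] at key
  have hprod : 0 ≤ μ.real H * osN p H (ind A) (ind B) := by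
    rw [key]
    exact add_nonneg (mul_nonneg (sub_nonneg.2 hh1) (sub_nonneg.2 hcov))
      (mul_nonneg (sub_nonneg.2 hHA) (sub_nonneg.2 hHB))
  by_cases hz : μ.real H = 0
  · -- every set inside `H` is null, and `n` vanishes
    have hHA0 : μ.real (H ∩ A) = 0 :=
      le_antisymm ((measureReal_mono Set.inter_subset_left).trans hz.le) measureReal_nonneg
    have hHB0 : μ.real (H ∩ B) = 0 :=
      le_antisymm ((measureReal_mono Set.inter_subset_left).trans hz.le) measureReal_nonneg
    have hHAB0 : μ.real (H ∩ A ∩ B) = 0 :=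
      le_antisymm ((measureReal_mono (Set.inter_subset_left.trans Set.inter_subset_left)).trans hz.le)
        measureReal_nonneg
    rw [osN_ind_ind, ← hμ, hz, hHA0, hHB0, hHAB0]
    simp
  · have hpos : 0 < μ.real H := lt_of_le_of_ne hh0 (Ne.symm hz)
    nlinarith [hprod, hpos]

omit [DecidableEq ι] in
/-- **Kahn C5 / Sahi `C₃` under the conditional-covariance criterion** (threshold slot): if `A, B` (increasing) are nonnegatively
correlated given `Th_t(F)`, then `0 ≤ E₃(1_{Th_t(F)}, 1_A, 1_B)`, every density vector. [this work] -/
theorem sahiE3_threshold_nonneg_of_condCov (p : ι → unitInterval) (F : Finset ι) (t : ℕ) {A B : Set (Set ι)}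
    (hA : IsUpperSet A) (hB : IsUpperSet B)
    (hcov : (prodBernoulli p).real ({ω : Set ι | t ≤ (F.filter (· ∈ ω)).card} ∩ A) *
        (prodBernoulli p).real ({ω : Set ι | t ≤ (F.filter (· ∈ ω)).card} ∩ B) ≤
      (prodBernoulli p).real {ω : Set ι | t ≤ (F.filter (· ∈ ω)).card} *
        (prodBernoulli p).real ({ω : Set ι | t ≤ (F.filter (· ∈ ω)).card} ∩ A ∩ B)) :
    0 ≤ sahiE3 (prodBernoulli p) {ω : Set ι | t ≤ (F.filter (· ∈ ω)).card} A B := by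
  rw [← osT_ind_ind, osT_eq_osMp_add_osN]
  exact add_nonneg (osMp_threshold_nonneg_all p F t hA hB)
    (osN_nonneg_of_condCov p (isUpperSet_threshold F t) hA hB hcov)

/-! ## §2 The layer-sum criterion -/

omit [Fintype ι] [DecidableEq ι] in
/-- **The layer grid inequality, summed hypothesis.**  As `layerGrid_nonneg`, but the high-layer hypothesis is only required for
the SUM: `Σ_{k ≥ t} α_k β_k / π_k ≤ Σ_{k ≥ t} γ_k` (Lean convention `x / 0 = 0`; since `α ≤ π` the summands with `π_k = 0` vanish). [this work] -/
theorem layerGrid_nonneg_of_sum (m t : ℕ) (π α β γ : ℕ → ℝ) (hπ : ∀ k, 0 ≤ π k) (hα : ∀ k, 0 ≤ α k) (hβ : ∀ k, 0 ≤ β k)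
    (hγ : ∀ k, 0 ≤ γ k)
    (hαπ : ∀ k, α k ≤ π k) (hβπ : ∀ k, β k ≤ π k) (hπ1 : ∑ k ∈ range (m + 1), π k = 1)
    (mlrA : ∀ j k, j ≤ k → α j * π k ≤ α k * π j) (mlrB : ∀ j k, j ≤ k → β j * π k ≤ β k * π j)
    (hsum : (∑ k ∈ range (m + 1), if t ≤ k then α k * β k / π k else 0) ≤
      ∑ k ∈ range (m + 1), if t ≤ k then γ k else 0) :
    0 ≤ (∑ k ∈ range (m + 1), if t ≤ k then α k else 0) * (∑ k ∈ range (m + 1), if t ≤ k then β k else 0)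
        + (1 - ∑ k ∈ range (m + 1), if t ≤ k then π k else 0) * (∑ k ∈ range (m + 1), if t ≤ k then γ k else 0)
        + (∑ k ∈ range (m + 1), if t ≤ k then π k else 0) * (∑ k ∈ range (m + 1), α k) * (∑ k ∈ range (m + 1), β k)
        - (∑ k ∈ range (m + 1), if t ≤ k then α k else 0) * (∑ k ∈ range (m + 1), β k)
        - (∑ k ∈ range (m + 1), if t ≤ k then β k else 0) * (∑ k ∈ range (m + 1), α k) := by
  -- low / high splits
  set ℓ : ℝ := ∑ k ∈ range (m + 1), if t ≤ k then 0 else π k with hℓ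
  set aL : ℝ := ∑ k ∈ range (m + 1), if t ≤ k then 0 else α k with haL
  set bL : ℝ := ∑ k ∈ range (m + 1), if t ≤ k then 0 else β k with hbL
  set aH : ℝ := ∑ k ∈ range (m + 1), if t ≤ k then α k else 0 with haH
  set bH : ℝ := ∑ k ∈ range (m + 1), if t ≤ k then β k else 0 with hbH
  set hH : ℝ := ∑ k ∈ range (m + 1), if t ≤ k then π k else 0 with hhH
  set G : ℝ := ∑ k ∈ range (m + 1), if t ≤ k then γ k else 0 with hG
  have splitπ : hH + ℓ = 1 := by
    rw [hhH, hℓ, ← Finset.sum_add_distrib, ← hπ1]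
    exact Finset.sum_congr rfl fun k _ => by split_ifs <;> simp
  have splitα : (∑ k ∈ range (m + 1), α k) = aH + aL := by
    rw [haH, haL, ← Finset.sum_add_distrib]
    exact Finset.sum_congr rfl fun k _ => by split_ifs <;> simp
  have splitβ : (∑ k ∈ range (m + 1), β k) = bH + bL := by
    rw [hbH, hbL, ← Finset.sum_add_distrib]
    exact Finset.sum_congr rfl fun k _ => by split_ifs <;> simp
  have hℓ0 : 0 ≤ ℓ := Finset.sum_nonneg fun k _ => by split_ifs; exacts [le_rfl, hπ k]
  have haL0 : 0 ≤ aL := Finset.sum_nonneg fun k _ => by split_ifs; exacts [le_rfl, hα k]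
  have hbL0 : 0 ≤ bL := Finset.sum_nonneg fun k _ => by split_ifs; exacts [le_rfl, hβ k]
  have hG0 : 0 ≤ G := Finset.sum_nonneg fun k _ => by split_ifs; exacts [hγ k, le_rfl]
  -- the target is `aL bL + ℓ G − ℓ a b`
  have key : 0 ≤ aL * bL + ℓ * G - ℓ * ((aH + aL) * (bH + bL)) := by
    by_cases hℓz : ℓ = 0
    · -- then every low layer is null, so `aL = bL = 0`
      have hπlow : ∀ k ∈ range (m + 1), ¬ t ≤ k → π k = 0 := by
        intro k hk hkt
        have h1 : (if t ≤ k then (0:ℝ) else π k) ≤ ℓ :=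
          Finset.single_le_sum (f := fun k => if t ≤ k then (0:ℝ) else π k) (fun k _ => by split_ifs; exacts [le_rfl, hπ k]) hk
        rw [if_neg hkt, hℓz] at h1
        exact le_antisymm h1 (hπ k)
      have haLz : aL = 0 := by
        rw [haL]; refine Finset.sum_eq_zero fun k hk => ?_
        split_ifs with hkt
        · rfl
        · exact le_antisymm ((hαπ k).trans (hπlow k hk hkt).le) (hα k)
      have hbLz : bL = 0 := by
        rw [hbL]; refine Finset.sum_eq_zero fun k hk => ?_
        split_ifs with hkt
        · rfl
        · exact le_antisymm ((hβπ k).trans (hπlow k hk hkt).le) (hβ k)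
      rw [haLz, hbLz, hℓz]; simp
    · have hℓpos : 0 < ℓ := lt_of_le_of_ne hℓ0 (Ne.symm hℓz)
      -- lumped layer profiles
      set φ : ℕ → ℝ := fun k => if t ≤ k then α k / π k else aL / ℓ with hφ
      set ψ : ℕ → ℝ := fun k => if t ≤ k then β k / π k else bL / ℓ with hψ
      have hπφ : ∀ k, π k * φ k = if t ≤ k then α k else π k * (aL / ℓ) := by
        intro k; rw [hφ]; dsimp only
        split_ifs with hkt
        · by_cases hπk : π k = 0
          · have : α k = 0 := le_antisymm ((hαπ k).trans hπk.le) (hα k)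
            rw [hπk, this]; simp
          · field_simp
        · rfl
      have hπψ : ∀ k, π k * ψ k = if t ≤ k then β k else π k * (bL / ℓ) := by
        intro k; rw [hψ]; dsimp only
        split_ifs with hkt
        · by_cases hπk : π k = 0
          · have : β k = 0 := le_antisymm ((hβπ k).trans hπk.le) (hβ k)
            rw [hπk, this]; simp
          · field_simp
        · rfl
      -- the summed high-layer term equals `Σ_{k ≥ t} α_k β_k / π_k`
      have hπφψ : ∀ k, π k * φ k * ψ k = if t ≤ k then α k * β k / π k else π k * (aL / ℓ) * (bL / ℓ) := by
        intro k; rw [hφ, hψ]; dsimp only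
        split_ifs with hkt
        · by_cases hπk : π k = 0
          · have : α k = 0 := le_antisymm ((hαπ k).trans hπk.le) (hα k)
            rw [hπk, this]; simp
          · field_simp
        · rfl
      -- sums of the lumped profiles
      have sφ : (∑ k ∈ range (m + 1), π k * φ k) = aH + aL := by
        rw [Finset.sum_congr rfl fun k _ => hπφ k]
        have : (∑ k ∈ range (m + 1), if t ≤ k then α k else π k * (aL / ℓ)) =
            aH + (∑ k ∈ range (m + 1), if t ≤ k then 0 else π k) * (aL / ℓ) := by
          rw [haH, Finset.sum_mul, ← Finset.sum_add_distrib]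
          exact Finset.sum_congr rfl fun k _ => by split_ifs <;> simp
        rw [this, ← hℓ]; field_simp
      have sψ : (∑ k ∈ range (m + 1), π k * ψ k) = bH + bL := by
        rw [Finset.sum_congr rfl fun k _ => hπψ k]
        have : (∑ k ∈ range (m + 1), if t ≤ k then β k else π k * (bL / ℓ)) =
            bH + (∑ k ∈ range (m + 1), if t ≤ k then 0 else π k) * (bL / ℓ) := by
          rw [hbH, Finset.sum_mul, ← Finset.sum_add_distrib]
          exact Finset.sum_congr rfl fun k _ => by split_ifs <;> simp
        rw [this, ← hℓ]; field_simp
      have sφψ : (∑ k ∈ range (m + 1), π k * φ k * ψ k) ≤ G + aL * bL / ℓ := by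
        rw [Finset.sum_congr rfl fun k _ => hπφψ k]
        have : (∑ k ∈ range (m + 1), if t ≤ k then α k * β k / π k else π k * (aL / ℓ) * (bL / ℓ)) =
            (∑ k ∈ range (m + 1), if t ≤ k then α k * β k / π k else 0)
              + (∑ k ∈ range (m + 1), if t ≤ k then 0 else π k) * (aL / ℓ) * (bL / ℓ) := by
          rw [Finset.sum_mul, Finset.sum_mul, ← Finset.sum_add_distrib]
          exact Finset.sum_congr rfl fun k _ => by split_ifs <;> simp
        rw [this, ← hℓ]
        have e : ℓ * (aL / ℓ) * (bL / ℓ) = aL * bL / ℓ := by field_simp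
        rw [e]
        linarith [hsum]
      -- comonotonicity of the lumped profiles on the support of `π`
      have lowφ : ∀ k, t ≤ k → π k ≠ 0 → aL / ℓ ≤ α k / π k := by
        intro k hkt hπk
        have hπkpos : 0 < π k := lt_of_le_of_ne (hπ k) (Ne.symm hπk)
        rw [div_le_div_iff₀ hℓpos hπkpos, haL, hℓ, Finset.sum_mul, Finset.mul_sum]
        refine Finset.sum_le_sum fun j hj => ?_
        split_ifs with hjt
        · simp
        · have hjk : j ≤ k := by omega
          rw [mul_comm (α k)]
          linarith [mlrA j k hjk]
      have lowψ : ∀ k, t ≤ k → π k ≠ 0 → bL / ℓ ≤ β k / π k := by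
        intro k hkt hπk
        have hπkpos : 0 < π k := lt_of_le_of_ne (hπ k) (Ne.symm hπk)
        rw [div_le_div_iff₀ hℓpos hπkpos, hbL, hℓ, Finset.sum_mul, Finset.mul_sum]
        refine Finset.sum_le_sum fun j hj => ?_
        split_ifs with hjt
        · simp
        · have hjk : j ≤ k := by omega
          rw [mul_comm (β k)]
          linarith [mlrB j k hjk]
      have monoφ : ∀ j k, j ≤ k → π j ≠ 0 → π k ≠ 0 → φ j ≤ φ k := by
        intro j k hjk hπj hπk
        have hπjpos : 0 < π j := lt_of_le_of_ne (hπ j) (Ne.symm hπj)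
        have hπkpos : 0 < π k := lt_of_le_of_ne (hπ k) (Ne.symm hπk)
        rw [hφ]; dsimp only
        by_cases hjt : t ≤ j
        · rw [if_pos hjt, if_pos (hjt.trans hjk), div_le_div_iff₀ hπjpos hπkpos]
          exact mlrA j k hjk
        · rw [if_neg hjt]
          by_cases hkt : t ≤ k
          · rw [if_pos hkt]; exact lowφ k hkt hπk
          · rw [if_neg hkt]
      have monoψ : ∀ j k, j ≤ k → π j ≠ 0 → π k ≠ 0 → ψ j ≤ ψ k := by
        intro j k hjk hπj hπk
        have hπjpos : 0 < π j := lt_of_le_of_ne (hπ j) (Ne.symm hπj)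
        have hπkpos : 0 < π k := lt_of_le_of_ne (hπ k) (Ne.symm hπk)
        rw [hψ]; dsimp only
        by_cases hjt : t ≤ j
        · rw [if_pos hjt, if_pos (hjt.trans hjk), div_le_div_iff₀ hπjpos hπkpos]
          exact mlrB j k hjk
        · rw [if_neg hjt]
          by_cases hkt : t ≤ k
          · rw [if_pos hkt]; exact lowψ k hkt hπk
          · rw [if_neg hkt]
      -- Chebyshev on the chain
      have cheb := ThreshGrid.sum_mul_sum_ge_of_pairs' (m + 1) π φ ψ hπ (fun j k hjk _ hπj hπk =>
        mul_nonneg_of_nonpos_of_nonpos (sub_nonpos.2 (monoφ j k hjk.le hπj hπk)) (sub_nonpos.2 (monoψ j k hjk.le hπj hπk)))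
      rw [hπ1, one_mul, sφ, sψ] at cheb
      have h3 : (aH + aL) * (bH + bL) ≤ G + aL * bL / ℓ := cheb.trans sφψ
      have h4 : ℓ * ((aH + aL) * (bH + bL)) ≤ ℓ * G + aL * bL := by
        have h5 := mul_le_mul_of_nonneg_left h3 hℓ0
        have e : ℓ * (G + aL * bL / ℓ) = ℓ * G + aL * bL := by field_simp
        linarith [h5, e]
      linarith
  -- rewrite the target in terms of the splits
  have hhH' : hH = 1 - ℓ := by linarith [splitπ]
  rw [splitα, splitβ, hhH']
  nlinarith [key]

omit [DecidableEq ι] in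
/-- **THE LAYER-SUM CRITERION for `(2′)`.**  For every product measure, every block `F`, threshold `t` and increasing events `A, B`: if
`Σ_{k ≥ t} μ(A ∩ {N_F=k})·μ(B ∩ {N_F=k}) / μ{N_F=k} ≤ μ(Th_t(F) ∩ A ∩ B)` — i.e. `Σ_{k ≥ t} μ(N_F = k)·Cov(1_A, 1_B ∣ N_F = k) ≥ 0`, the
high layers of `F` carry nonnegative covariance IN TOTAL — then `0 ≤ n(Th_t(F); 1_A, 1_B)`, i.e. `Cov(1_A,1_B) ≥ μ(N_F < t)·Cov(1_A,1_B ∣ N_F < t)`.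
[this work] -/
theorem osN_threshold_nonneg_of_layerSum (p : ι → unitInterval) (F : Finset ι) (t : ℕ) {A B : Set (Set ι)}
    (hA : IsUpperSet A) (hB : IsUpperSet B)
    (hsum : (∑ k ∈ range (F.card + 1), if t ≤ k then
        (prodBernoulli p).real (A ∩ {ω : Set ι | (F.filter (· ∈ ω)).card = k}) *
            (prodBernoulli p).real (B ∩ {ω : Set ι | (F.filter (· ∈ ω)).card = k}) /
          (prodBernoulli p).real {ω : Set ι | (F.filter (· ∈ ω)).card = k} else 0) ≤
      (prodBernoulli p).real ({ω : Set ι | t ≤ (F.filter (· ∈ ω)).card} ∩ A ∩ B)) :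
    0 ≤ osN p {ω : Set ι | t ≤ (F.filter (· ∈ ω)).card} (ind A) (ind B) := by
  set μ := prodBernoulli p with hμ
  set H : Set (Set ι) := {ω : Set ι | t ≤ (F.filter (· ∈ ω)).card} with hH
  -- layer data
  obtain ⟨π, hπ⟩ : ∃ π : ℕ → ℝ, ∀ k, π k = μ.real {ω : Set ι | (F.filter (· ∈ ω)).card = k} := ⟨_, fun _ => rfl⟩
  obtain ⟨α, hα⟩ : ∃ α : ℕ → ℝ, ∀ k, α k = μ.real (A ∩ {ω : Set ι | (F.filter (· ∈ ω)).card = k}) := ⟨_, fun _ => rfl⟩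
  obtain ⟨β, hβ⟩ : ∃ β : ℕ → ℝ, ∀ k, β k = μ.real (B ∩ {ω : Set ι | (F.filter (· ∈ ω)).card = k}) := ⟨_, fun _ => rfl⟩
  obtain ⟨γ, hγ⟩ : ∃ γ : ℕ → ℝ, ∀ k, γ k = μ.real (A ∩ B ∩ {ω : Set ι | (F.filter (· ∈ ω)).card = k}) := ⟨_, fun _ => rfl⟩
  have hπ0 : ∀ k, 0 ≤ π k := fun k => by rw [hπ]; exact measureReal_nonneg
  have hα0 : ∀ k, 0 ≤ α k := fun k => by rw [hα]; exact measureReal_nonneg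
  have hβ0 : ∀ k, 0 ≤ β k := fun k => by rw [hβ]; exact measureReal_nonneg
  have hγ0 : ∀ k, 0 ≤ γ k := fun k => by rw [hγ]; exact measureReal_nonneg
  have hαπ : ∀ k, α k ≤ π k := fun k => by rw [hα, hπ]; exact measureReal_mono Set.inter_subset_right
  have hβπ : ∀ k, β k ≤ π k := fun k => by rw [hβ, hπ]; exact measureReal_mono Set.inter_subset_right
  have hπ1 : ∑ k ∈ range (F.card + 1), π k = 1 := by
    rw [Finset.sum_congr rfl fun k _ => hπ k]; exact sum_real_layer_eq_one p F
  have huniv : DeterminedBy (Set.univ : Set (Set ι)) ((↑F : Set ι)ᶜ) := by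
    rw [determinedBy_iff]; intro ω ω' _; simp
  have mlrA : ∀ j k, j ≤ k → α j * π k ≤ α k * π j := fun j k hjk => by
    have h := real_inter_inter_layer_mul_le p F hA huniv hjk
    rw [Set.inter_univ] at h
    rw [hα, hα, hπ, hπ]; exact h
  have mlrB : ∀ j k, j ≤ k → β j * π k ≤ β k * π j := fun j k hjk => by
    have h := real_inter_inter_layer_mul_le p F hB huniv hjk
    rw [Set.inter_univ] at h
    rw [hβ, hβ, hπ, hπ]; exact h
  -- the six measures as layer sums
  have eHA : μ.real (H ∩ A) = ∑ k ∈ range (F.card + 1), if t ≤ k then α k else 0 := by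
    rw [real_eq_sum_layers p F (H ∩ A)]
    exact Finset.sum_congr rfl fun k _ => by rw [hα]; exact real_threshold_inter_layer p F t k A
  have eHB : μ.real (H ∩ B) = ∑ k ∈ range (F.card + 1), if t ≤ k then β k else 0 := by
    rw [real_eq_sum_layers p F (H ∩ B)]
    exact Finset.sum_congr rfl fun k _ => by rw [hβ]; exact real_threshold_inter_layer p F t k B
  have eHAB : μ.real (H ∩ A ∩ B) = ∑ k ∈ range (F.card + 1), if t ≤ k then γ k else 0 := by
    rw [Set.inter_assoc, real_eq_sum_layers p F (H ∩ (A ∩ B))]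
    exact Finset.sum_congr rfl fun k _ => by rw [hγ]; exact real_threshold_inter_layer p F t k (A ∩ B)
  have eH : μ.real H = ∑ k ∈ range (F.card + 1), if t ≤ k then π k else 0 := by
    rw [← Set.inter_univ H, real_eq_sum_layers p F (H ∩ Set.univ)]
    refine Finset.sum_congr rfl fun k _ => ?_
    rw [hπ, real_threshold_inter_layer p F t k Set.univ, Set.univ_inter]
  have eA : μ.real A = ∑ k ∈ range (F.card + 1), α k := by
    rw [real_eq_sum_layers p F A]; exact Finset.sum_congr rfl fun k _ => (hα k).symm
  have eB : μ.real B = ∑ k ∈ range (F.card + 1), β k := by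
    rw [real_eq_sum_layers p F B]; exact Finset.sum_congr rfl fun k _ => (hβ k).symm
  have hsum' : (∑ k ∈ range (F.card + 1), if t ≤ k then α k * β k / π k else 0) ≤
      ∑ k ∈ range (F.card + 1), if t ≤ k then γ k else 0 := by
    rw [← eHAB]
    refine le_of_eq_of_le (Finset.sum_congr rfl fun k _ => ?_) hsum
    rw [hα, hβ, hπ]
  have hgrid := layerGrid_nonneg_of_sum F.card t π α β γ hπ0 hα0 hβ0 hγ0 hαπ hβπ hπ1 mlrA mlrB hsum'
  rw [osN_ind_ind, ← hμ, eHA, eHB, eHAB, eH, eA, eB]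
  linarith [hgrid]

omit [DecidableEq ι] in
/-- **KAHN C5 / SAHI `C₃` under the layer-sum criterion.**  For every product measure, `F`, `t` and increasing `A, B` with
`Σ_{k ≥ t} μ(N_F = k)·Cov(1_A,1_B ∣ N_F = k) ≥ 0` (in the division form of `osN_threshold_nonneg_of_layerSum`):
`0 ≤ E₃(1_{Th_t(F)}, 1_A, 1_B)`. [this work] -/
theorem sahiE3_threshold_nonneg_of_layerSum (p : ι → unitInterval) (F : Finset ι) (t : ℕ) {A B : Set (Set ι)}
    (hA : IsUpperSet A) (hB : IsUpperSet B)
    (hsum : (∑ k ∈ range (F.card + 1), if t ≤ k then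
        (prodBernoulli p).real (A ∩ {ω : Set ι | (F.filter (· ∈ ω)).card = k}) *
            (prodBernoulli p).real (B ∩ {ω : Set ι | (F.filter (· ∈ ω)).card = k}) /
          (prodBernoulli p).real {ω : Set ι | (F.filter (· ∈ ω)).card = k} else 0) ≤
      (prodBernoulli p).real ({ω : Set ι | t ≤ (F.filter (· ∈ ω)).card} ∩ A ∩ B)) :
    0 ≤ sahiE3 (prodBernoulli p) {ω : Set ι | t ≤ (F.filter (· ∈ ω)).card} A B := by
  rw [← osT_ind_ind, osT_eq_osMp_add_osN]
  exact add_nonneg (osMp_threshold_nonneg_all p F t hA hB) (osN_threshold_nonneg_of_layerSum p F t hA hB hsum)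

end SahiOneStep

end Summit.CriticalPhenomena.PercolationContinuityZ3.Theorems
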